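import Literature.InformationTheory.Entanglement.TwoRebitSeparabilityProbabilitySlices
import Mathlib.Analysis.Matrix.PosDef
import Mathlib.Analysis.SpecialFunctions.PolarCoord
import Mathlib.Analysis.SpecialFunctions.Integrals.Basic
import HarnessLib

/-!
# The volume of the operator-norm unit ball of real `2 × 2` matrices: `λ₄(𝔹) = 2π²/3`

Lovas–Andai 2017, Table 2 / §5: `χ₁(1) = (2/3) π²`, where `χ₁(1) = λ₄(𝔹_ℝ)` is the Lebesgue
measure of the unit ball of the operator norm in `ℝ^{2×2}` — the normalisation constant of the
defect function `χ̃₁ = χ₁/χ₁(1)` in the two-rebit separability probability (Corollary 2,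
Theorem 2). Here `𝔹 = rebitOpBall = {K | 𝟙 − KᵀK ≽ 0}` (closed ball; the sphere is null).

## Proof

Write `K = [[p + r, −q + s], [q + s, p − r]]` (conformal part `(p, q)`, anticonformal part
`(r, s)`); the singular values of `K` are `u + v` and `|u − v|` with `u = |(p, q)|`, `v = |(r, s)|`,
so `‖K‖ ≤ 1 ↔ u + v ≤ 1` (`mem_rebitOpBall_iff_conf`, proved from the `2 × 2`
positivity criterion `diag ≥ 0 ∧ det ≥ 0` for `𝟙 − KᵀK`, whose trace is `2 − 2(u² + v²)` and
whose determinant is `(1 − (u+v)²)(1 − (u−v)²)`). The coordinate change has Jacobian `4`, and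
`λ₄{(x, y) ∈ ℝ² × ℝ² | |x| + |y| ≤ 1} = ∫_{|x| ≤ 1} π (1 − |x|)² dx = 2π² ∫₀¹ ρ (1 − ρ)² dρ = π²/6`
(polar coordinates twice), whence `λ₄(𝔹) = 4 · π²/6 = 2π²/3`.

## References

* [LovasAndai2017] A. Lovas, A. Andai, Invariance of separability probability over reduced states
  in 4 × 4 bipartite systems, J. Phys. A 50 (2017) 295303, Definition 1, Table 2 and §5
  (`χ₁(1) = 2π²/3`).
-/

noncomputable section

open MeasureTheory Set Real
open scoped ENNReal Matrix

namespace Literature.InformationTheory.Entanglement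

/-! ### Positive semidefiniteness of real symmetric `2 × 2` matrices -/

/-- A real symmetric `2 × 2` matrix with non-negative diagonal and non-negative determinant is
positive semidefinite. [folklore] -/
theorem posSemidef_fin_two_of {S : Matrix (Fin 2) (Fin 2) ℝ} (hsym : S 1 0 = S 0 1)
    (ha : 0 ≤ S 0 0) (hc : 0 ≤ S 1 1) (hdet : S 0 1 * S 0 1 ≤ S 0 0 * S 1 1) :
    S.PosSemidef := by
  have hH : S.IsHermitian := by
    apply Matrix.IsHermitian.ext
    intro i j
    fin_cases i <;> fin_cases j <;> simp [hsym]
  refine Matrix.PosSemidef.of_dotProduct_mulVec_nonneg hH fun x => ?_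
  simp only [star_trivial, Matrix.mulVec, dotProduct, Fin.sum_univ_two, hsym]
  rcases ha.lt_or_eq with ha' | ha'
  · have key : S 0 0 * (x 0 * (S 0 0 * x 0 + S 0 1 * x 1) + x 1 * (S 0 1 * x 0 + S 1 1 * x 1)) =
        (S 0 0 * x 0 + S 0 1 * x 1) ^ 2 + (S 0 0 * S 1 1 - S 0 1 * S 0 1) * x 1 ^ 2 := by ring
    have hnn : 0 ≤ (S 0 0 * x 0 + S 0 1 * x 1) ^ 2 + (S 0 0 * S 1 1 - S 0 1 * S 0 1) * x 1 ^ 2 := by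
      have h1 := sq_nonneg (S 0 0 * x 0 + S 0 1 * x 1)
      have h2 : 0 ≤ (S 0 0 * S 1 1 - S 0 1 * S 0 1) * x 1 ^ 2 :=
        mul_nonneg (by linarith) (sq_nonneg _)
      linarith
    rw [← key] at hnn
    have hQ := (mul_nonneg_iff_of_pos_left ha').1 hnn
    linarith [hQ]
  · have hb : S 0 1 = 0 := by
      have h : S 0 1 * S 0 1 ≤ 0 := by rw [← ha'] at hdet; simpa using hdet
      nlinarith [sq_nonneg (S 0 1)]
    rw [← ha', hb]
    nlinarith [sq_nonneg (x 1), hc]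

/-- A positive semidefinite real `2 × 2` matrix has non-negative diagonal and determinant.
[folklore] -/
theorem diag_det_nonneg_of_posSemidef_fin_two {S : Matrix (Fin 2) (Fin 2) ℝ} (hS : S.PosSemidef) :
    0 ≤ S 0 0 ∧ 0 ≤ S 1 1 ∧ S 0 1 * S 1 0 ≤ S 0 0 * S 1 1 := by
  refine ⟨hS.diag_nonneg, hS.diag_nonneg, ?_⟩
  have h := hS.det_nonneg
  rw [Matrix.det_fin_two] at h
  linarith

/-! ### The conformal / anticonformal coordinates -/

/-- For `u, v ≥ 0`: `u² + v² ≤ 1` and `(1 − (u+v)²)(1 − (u−v)²) ≥ 0` force `u + v ≤ 1`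
(the two singular values `u + v ≥ |u − v|` of a `2 × 2` matrix are both `≤ 1` iff the larger is).
[folklore] -/
theorem add_le_one_of_singular_values {u v : ℝ} (hu : 0 ≤ u) (hv : 0 ≤ v)
    (htr : u ^ 2 + v ^ 2 ≤ 1) (hdet : 0 ≤ (1 - (u + v) ^ 2) * (1 - (u - v) ^ 2)) :
    u + v ≤ 1 := by
  have hsq : (u + v) ^ 2 ≤ 1 := by
    rcases (mul_nonneg hu hv).lt_or_eq with huv | huv
    · have h2 : 0 < 1 - (u - v) ^ 2 := by nlinarith
      by_contra h
      rw [not_le] at h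
      have h3 : 1 - (u + v) ^ 2 < 0 := by linarith
      have := mul_neg_of_neg_of_pos h3 h2
      linarith
    · nlinarith
  nlinarith [sq_nonneg (u + v)]

/-- The linear map `K ↦ (p, q, r, s) = ((k00 + k11)/2, (k10 − k01)/2, (k00 − k11)/2, (k01 + k10)/2)`
(conformal and anticonformal parts: `K = [[p + r, −q + s], [q + s, p − r]]`), as a matrix.
[folklore] -/
def rebitConfMatrix : Matrix (Fin 4) (Fin 4) ℝ :=
  !![1 / 2, 0, 0, 1 / 2; 0, -1 / 2, 1 / 2, 0; 1 / 2, 0, 0, -1 / 2; 0, 1 / 2, 1 / 2, 0]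

/-- Unfolding of the coordinate map. [folklore] -/
theorem rebitConfMatrix_mulVec (k : Fin 4 → ℝ) :
    rebitConfMatrix *ᵥ k =
      ![(k 0 + k 3) / 2, (k 2 - k 1) / 2, (k 0 - k 3) / 2, (k 1 + k 2) / 2] := by
  ext i
  fin_cases i <;> simp [rebitConfMatrix, Matrix.mulVec, dotProduct, Fin.sum_univ_four] <;> ring

/-- The coordinate map is `1/√2` times an orthogonal map: `P Pᵀ = ½ 𝟙`. [folklore] -/
theorem rebitConfMatrix_mul_transpose :
    rebitConfMatrix * rebitConfMatrixᵀ = (1 / 2 : ℝ) • (1 : Matrix (Fin 4) (Fin 4) ℝ) := by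
  ext i j
  fin_cases i <;> fin_cases j <;>
    simp [rebitConfMatrix, Matrix.mul_apply, Fin.sum_univ_four] <;> norm_num

/-- `|det P| = 1/4` (from `det(P)² = det(½ 𝟙) = 1/16`). [folklore] -/
theorem abs_det_rebitConfMatrix : |rebitConfMatrix.det| = 1 / 4 := by
  have h := congrArg Matrix.det rebitConfMatrix_mul_transpose
  rw [Matrix.det_mul, Matrix.det_transpose, Matrix.det_smul, Matrix.det_one,
    Fintype.card_fin] at h
  have h2 : |rebitConfMatrix.det| ^ 2 = (1 / 4 : ℝ) ^ 2 := by
    rw [sq_abs, sq]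
    rw [h]
    norm_num
  exact (pow_left_inj₀ (abs_nonneg _) (by norm_num) two_ne_zero).1 h2

/-- The body `{(x, y) ∈ ℝ² × ℝ² | |x| + |y| ≤ 1}` in the coordinates `(p, q, r, s) ∈ ℝ⁴`.
[folklore] -/
def rebitConfBody : Set (Fin 4 → ℝ) :=
  {y | Real.sqrt (y 0 ^ 2 + y 1 ^ 2) + Real.sqrt (y 2 ^ 2 + y 3 ^ 2) ≤ 1}

/-- `rebitConfBody` is closed. [folklore] -/
theorem isClosed_rebitConfBody : IsClosed rebitConfBody :=
  isClosed_le (by fun_prop) continuous_const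

/-- **The unit ball in conformal/anticonformal coordinates**: `K ∈ 𝔹 ↔ u + v ≤ 1`,
`u = |(p, q)|`, `v = |(r, s)|` (the singular values of `K` are `u + v ≥ |u − v|`).
[cite: LovasAndai2017, Lemma 5 (singular values of 2 × 2 matrices) and Lemma 3] -/
theorem mem_rebitOpBall_iff_conf (k : Fin 4 → ℝ) :
    k ∈ rebitOpBall ↔ rebitConfMatrix *ᵥ k ∈ rebitConfBody := by
  rw [rebitConfMatrix_mulVec]
  simp only [rebitConfBody, mem_setOf_eq, Matrix.cons_val_zero, Matrix.cons_val_one,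
    Matrix.cons_val]
  set p := (k 0 + k 3) / 2 with hp
  set q := (k 2 - k 1) / 2 with hq
  set r := (k 0 - k 3) / 2 with hr
  set s := (k 1 + k 2) / 2 with hs
  have hk0 : k 0 = p + r := by rw [hp, hr]; ring
  have hk3 : k 3 = p - r := by rw [hp, hr]; ring
  have hk1 : k 1 = -q + s := by rw [hq, hs]; ring
  have hk2 : k 2 = q + s := by rw [hq, hs]; ring
  clear_value p q r s
  set u := Real.sqrt (p ^ 2 + q ^ 2) with hu
  set v := Real.sqrt (r ^ 2 + s ^ 2) with hv
  have hu0 : 0 ≤ u := Real.sqrt_nonneg _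
  have hv0 : 0 ≤ v := Real.sqrt_nonneg _
  have hu2 : u ^ 2 = p ^ 2 + q ^ 2 := by rw [hu]; exact Real.sq_sqrt (by positivity)
  have hv2 : v ^ 2 = r ^ 2 + s ^ 2 := by rw [hv]; exact Real.sq_sqrt (by positivity)
  clear_value u v
  have hcs : (p * r + q * s) ^ 2 ≤ u ^ 2 * v ^ 2 := by
    rw [hu2, hv2]; nlinarith [sq_nonneg (p * s - q * r)]
  have hcs' : |p * r + q * s| ≤ u * v := by
    rw [← Real.sqrt_sq (mul_nonneg hu0 hv0), ← Real.sqrt_sq_eq_abs]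
    exact Real.sqrt_le_sqrt (by rw [mul_pow]; exact hcs)
  have hcs1 := (abs_le.1 hcs').1
  have hcs2 := (abs_le.1 hcs').2
  -- the entries of `𝟙 − KᵀK`
  have e00 : (1 - (matZ k)ᵀ * matZ k) 0 0 = 1 - u ^ 2 - v ^ 2 - 2 * (p * r + q * s) := by
    simp [matZ, Matrix.mul_apply, Fin.sum_univ_two, hk0, hk2, hu2, hv2]; ring
  have e11 : (1 - (matZ k)ᵀ * matZ k) 1 1 = 1 - u ^ 2 - v ^ 2 + 2 * (p * r + q * s) := by
    simp [matZ, Matrix.mul_apply, Fin.sum_univ_two, hk1, hk3, hu2, hv2]; ring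
  have e01 : (1 - (matZ k)ᵀ * matZ k) 0 1 = 2 * (q * r - p * s) := by
    simp [matZ, Matrix.mul_apply, Fin.sum_univ_two, hk0, hk1, hk2, hk3]; ring
  have e10 : (1 - (matZ k)ᵀ * matZ k) 1 0 = 2 * (q * r - p * s) := by
    simp [matZ, Matrix.mul_apply, Fin.sum_univ_two, hk0, hk1, hk2, hk3]; ring
  have hdet_id : (1 - u ^ 2 - v ^ 2 - 2 * (p * r + q * s)) *
      (1 - u ^ 2 - v ^ 2 + 2 * (p * r + q * s)) - (2 * (q * r - p * s)) * (2 * (q * r - p * s)) =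
      (1 - (u + v) ^ 2) * (1 - (u - v) ^ 2) := by
    have hPQ : (p * r + q * s) ^ 2 + (q * r - p * s) ^ 2 = u ^ 2 * v ^ 2 := by
      rw [hu2, hv2]; ring
    linear_combination (-4) * hPQ
  constructor
  · intro hk
    obtain ⟨h0, h1, hd⟩ := diag_det_nonneg_of_posSemidef_fin_two hk
    rw [e00] at h0 hd
    rw [e11] at h1 hd
    rw [e01, e10] at hd
    refine add_le_one_of_singular_values hu0 hv0 (by linarith) ?_
    rw [← hdet_id]
    linarith
  · intro huv
    have hsq : (u + v) ^ 2 ≤ 1 := by nlinarith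
    refine posSemidef_fin_two_of (by rw [e01, e10]) ?_ ?_ ?_
    · rw [e00]; linarith
    · rw [e11]; linarith
    · rw [e00, e11, e01]
      have h1 : 0 ≤ 1 - (u + v) ^ 2 := by linarith
      have h2 : 0 ≤ 1 - (u - v) ^ 2 := by
        have h4 : (u + v) ^ 2 - (u - v) ^ 2 = 4 * (u * v) := by ring
        have h5 := mul_nonneg hu0 hv0
        linarith
      have := mul_nonneg h1 h2
      rw [← hdet_id] at this
      linarith

/-- `𝔹` is the preimage of `rebitConfBody` under the coordinate map. [folklore] -/
theorem rebitOpBall_eq_preimage :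
    rebitOpBall = Matrix.toLin' rebitConfMatrix ⁻¹' rebitConfBody := by
  ext k
  rw [mem_preimage, Matrix.toLin'_apply]
  exact mem_rebitOpBall_iff_conf k

/-- **Jacobian step**: `λ₄(𝔹) = 4 · λ₄(rebitConfBody)`. [folklore] -/
theorem volume_rebitOpBall_eq_four_mul :
    volume rebitOpBall = 4 * volume rebitConfBody := by
  have hdet : LinearMap.det (Matrix.toLin' rebitConfMatrix) ≠ 0 := by
    rw [LinearMap.det_toLin']
    intro h
    have h1 := abs_det_rebitConfMatrix
    rw [h, abs_zero] at h1
    norm_num at h1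
  rw [rebitOpBall_eq_preimage, Measure.addHaar_preimage_linearMap volume hdet,
    LinearMap.det_toLin', abs_inv, abs_det_rebitConfMatrix]
  norm_num

/-! ### Radial integration on `ℝ²` -/

/-- **Radial functions on `ℝ²`**: `∫⁻ x, g(|x|) = 2π ∫⁻ r > 0, r g(r)` (polar coordinates).
[folklore] -/
theorem lintegral_radial_fin_two {g : ℝ → ℝ≥0∞} (hg : Measurable g) :
    ∫⁻ x : Fin 2 → ℝ, g (Real.sqrt (x 0 ^ 2 + x 1 ^ 2)) =
      ENNReal.ofReal (2 * π) * ∫⁻ r in Ioi (0 : ℝ), ENNReal.ofReal r * g r := by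
  have h2 : MeasurePreserving (MeasurableEquiv.finTwoArrow (α := ℝ)).symm
      (volume.prod volume) volume :=
    MeasurePreserving.symm _ (volume_preserving_finTwoArrow ℝ)
  rw [← h2.lintegral_comp_emb (MeasurableEquiv.finTwoArrow (α := ℝ)).symm.measurableEmbedding]
  simp only [MeasurableEquiv.finTwoArrow_symm_apply, Fin.cons_zero, Fin.cons_one]
  rw [← Measure.volume_eq_prod, ← lintegral_comp_polarCoord_symm]
  have hpt : ∀ x ∈ polarCoord.target,
      ENNReal.ofReal x.1 • g (Real.sqrt ((polarCoord.symm x).1 ^ 2 + (polarCoord.symm x).2 ^ 2)) =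
        ENNReal.ofReal x.1 * g x.1 := by
    rintro ⟨r, θ⟩ ⟨hr, -⟩
    simp only [polarCoord_symm_apply, smul_eq_mul]
    congr 2
    have : (r * cos θ) ^ 2 + (r * sin θ) ^ 2 = r ^ 2 := by
      have := sin_sq_add_cos_sq θ
      nlinarith [this]
    rw [this, Real.sqrt_sq (le_of_lt hr)]
  rw [setLIntegral_congr_fun polarCoord.open_target.measurableSet hpt,
    show polarCoord.target = Ioi (0 : ℝ) ×ˢ Ioo (-π) π from rfl, Measure.volume_eq_prod,
    setLIntegral_prod]
  · have hin : ∀ r : ℝ, ∫⁻ _ in Ioo (-π) π, ENNReal.ofReal r * g r =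
        ENNReal.ofReal (2 * π) * (ENNReal.ofReal r * g r) := by
      intro r
      rw [setLIntegral_const, Real.volume_Ioo, mul_comm]
      congr 2
      ring
    simp_rw [hin]
    rw [lintegral_const_mul' _ _ ENNReal.ofReal_ne_top]
  · exact ((ENNReal.measurable_ofReal.comp measurable_fst).mul (hg.comp measurable_fst)).aemeasurable

/-- `∫⁻ r ∈ (0, ∞), r · 𝟙[r ≤ c] = c²/2` for `c ≥ 0`. [folklore] -/
theorem lintegral_Ioi_ofReal_mul_indicator_le {c : ℝ} (hc : 0 ≤ c) :
    ∫⁻ r in Ioi (0 : ℝ), ENNReal.ofReal r * (Iic c).indicator 1 r = ENNReal.ofReal (c ^ 2 / 2) := by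
  have h1 : ∀ r : ℝ, ENNReal.ofReal r * (Iic c).indicator 1 r =
      (Iic c).indicator (fun r => ENNReal.ofReal r) r := by
    intro r
    by_cases h : r ∈ Iic c <;> simp [h]
  simp_rw [h1]
  rw [lintegral_indicator measurableSet_Iic, Measure.restrict_restrict measurableSet_Iic,
    Iic_inter_Ioi, ← ofReal_integral_eq_lintegral_ofReal]
  · rw [← intervalIntegral.integral_of_le hc, integral_id]
    simp
  · exact (continuous_id.integrableOn_Icc).mono_set Ioc_subset_Icc_self
  · exact (ae_restrict_iff' measurableSet_Ioc).2 (Filter.Eventually.of_forall fun r hr => hr.1.le)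

/-- **Area of a disc**: `λ₂{x ∈ ℝ² | |x| ≤ c} = π c²` (`c ≥ 0`). [folklore] -/
theorem volume_disc_fin_two {c : ℝ} (hc : 0 ≤ c) :
    volume {x : Fin 2 → ℝ | Real.sqrt (x 0 ^ 2 + x 1 ^ 2) ≤ c} = ENNReal.ofReal (π * c ^ 2) := by
  have hmeas : MeasurableSet {x : Fin 2 → ℝ | Real.sqrt (x 0 ^ 2 + x 1 ^ 2) ≤ c} :=
    (isClosed_le (by fun_prop) continuous_const).measurableSet
  rw [← lintegral_indicator_one hmeas]
  have h1 : (fun x : Fin 2 → ℝ => {x : Fin 2 → ℝ | Real.sqrt (x 0 ^ 2 + x 1 ^ 2) ≤ c}.indicator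
      (1 : (Fin 2 → ℝ) → ℝ≥0∞) x) =
      fun x => (Iic c).indicator 1 (Real.sqrt (x 0 ^ 2 + x 1 ^ 2)) := by
    funext x
    simp only [indicator, mem_setOf_eq, mem_Iic, Pi.one_apply]
  rw [h1, lintegral_radial_fin_two ((measurable_one.indicator measurableSet_Iic)),
    lintegral_Ioi_ofReal_mul_indicator_le hc, ← ENNReal.ofReal_mul (by positivity)]
  congr 1
  ring

/-! ### The volume of `rebitConfBody` and of `𝔹` -/

/-- The measurable splitting `ℝ⁴ ≃ ℝ² × ℝ²`, `y ↦ ((y0, y1), (y2, y3))`. [folklore] -/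
def rebitConfSplit : (Fin 4 → ℝ) ≃ᵐ (Fin 2 → ℝ) × (Fin 2 → ℝ) :=
  (MeasurableEquiv.piCongrLeft (fun _ : Fin 4 => ℝ)
      (finSumFinEquiv (m := 2) (n := 2))).symm.trans
    (MeasurableEquiv.sumPiEquivProdPi fun _ : Fin 2 ⊕ Fin 2 => ℝ)

/-- The inverse splitting. [folklore] -/
theorem rebitConfSplit_symm_apply (x y : Fin 2 → ℝ) :
    rebitConfSplit.symm (x, y) = ![x 0, x 1, y 0, y 1] := by
  funext i
  fin_cases i <;> rfl

/-- The splitting preserves Lebesgue measure. [folklore] -/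
theorem measurePreserving_rebitConfSplit :
    MeasurePreserving rebitConfSplit (volume : Measure (Fin 4 → ℝ))
      (volume : Measure ((Fin 2 → ℝ) × (Fin 2 → ℝ))) :=
  (volume_measurePreserving_sumPiEquivProdPi fun _ : Fin 2 ⊕ Fin 2 => ℝ).comp
    (MeasurePreserving.symm _
      (volume_measurePreserving_piCongrLeft (fun _ : Fin 4 => ℝ)
        (finSumFinEquiv (m := 2) (n := 2))))

/-- `∫₀¹ ρ (1 − ρ)² dρ = 1/12`. [folklore] -/
theorem integral_rho_one_sub_sq : ∫ ρ in (0 : ℝ)..1, ρ * (1 - ρ) ^ 2 = 1 / 12 := by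
  have h : ∀ ρ ∈ uIcc (0 : ℝ) 1, HasDerivAt (fun ρ : ℝ => ρ * ρ * (1 / 2) -
      ρ * ρ * ρ * (2 / 3) + ρ * ρ * ρ * ρ * (1 / 4)) (ρ * (1 - ρ) ^ 2) ρ := by
    intro ρ _
    have hid := hasDerivAt_id ρ
    have h2 := hid.mul hid
    have h3 := h2.mul hid
    have h4 := h3.mul hid
    refine (((h2.mul_const (1 / 2)).sub (h3.mul_const (2 / 3))).add
      (h4.mul_const (1 / 4))).congr_deriv ?_
    simp only [Pi.mul_apply, id]
    ring
  rw [intervalIntegral.integral_eq_sub_of_hasDerivAt h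
    ((by fun_prop : Continuous fun ρ : ℝ => ρ * (1 - ρ) ^ 2).intervalIntegrable 0 1)]
  norm_num

/-- **`λ₄{(x, y) ∈ ℝ² × ℝ² | |x| + |y| ≤ 1} = π²/6`** (Fubini, the disc of radius `1 − |x|`, and
a radial integral). [folklore] -/
theorem volume_rebitConfBody : volume rebitConfBody = ENNReal.ofReal (π ^ 2 / 6) := by
  have hmeas : MeasurableSet rebitConfBody := isClosed_rebitConfBody.measurableSet
  have h1 : volume rebitConfBody =
      (volume : Measure ((Fin 2 → ℝ) × (Fin 2 → ℝ))) (rebitConfSplit.symm ⁻¹' rebitConfBody) :=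
    (measurePreserving_rebitConfSplit.symm.measure_preimage hmeas.nullMeasurableSet).symm
  rw [h1, Measure.volume_eq_prod, Measure.prod_apply (hmeas.preimage rebitConfSplit.symm.measurable)]
  -- the slices are discs of radius `1 − |x|`
  have hslice : ∀ x : Fin 2 → ℝ, volume (Prod.mk x ⁻¹' (rebitConfSplit.symm ⁻¹' rebitConfBody)) =
      (Iic (1 : ℝ)).indicator (fun ρ => ENNReal.ofReal (π * (1 - ρ) ^ 2))
        (Real.sqrt (x 0 ^ 2 + x 1 ^ 2)) := by
    intro x
    have hset : Prod.mk x ⁻¹' (rebitConfSplit.symm ⁻¹' rebitConfBody) =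
        {y : Fin 2 → ℝ | Real.sqrt (y 0 ^ 2 + y 1 ^ 2) ≤ 1 - Real.sqrt (x 0 ^ 2 + x 1 ^ 2)} := by
      ext y
      simp only [mem_preimage, rebitConfSplit_symm_apply, rebitConfBody, mem_setOf_eq,
        Matrix.cons_val_zero, Matrix.cons_val_one, Matrix.cons_val]
      constructor <;> intro h <;> linarith
    rw [hset]
    by_cases hx : Real.sqrt (x 0 ^ 2 + x 1 ^ 2) ≤ 1
    · rw [indicator_of_mem (mem_Iic.2 hx), volume_disc_fin_two (sub_nonneg.2 hx)]
    · rw [indicator_of_notMem (by simpa using hx)]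
      have hempty : {y : Fin 2 → ℝ | Real.sqrt (y 0 ^ 2 + y 1 ^ 2) ≤
          1 - Real.sqrt (x 0 ^ 2 + x 1 ^ 2)} = ∅ := by
        ext y
        simp only [mem_setOf_eq, mem_empty_iff_false, iff_false, not_le]
        have := Real.sqrt_nonneg (y 0 ^ 2 + y 1 ^ 2)
        rw [not_le] at hx
        linarith
      rw [hempty, measure_empty]
  simp_rw [hslice]
  rw [lintegral_radial_fin_two]
  · have h2 : ∀ r : ℝ, ENNReal.ofReal r * (Iic (1 : ℝ)).indicator
        (fun ρ => ENNReal.ofReal (π * (1 - ρ) ^ 2)) r =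
        (Iic (1 : ℝ)).indicator (fun ρ => ENNReal.ofReal (π * (ρ * (1 - ρ) ^ 2))) r := by
      intro r
      by_cases h : r ∈ Iic (1 : ℝ)
      · rw [indicator_of_mem h, indicator_of_mem h]
        by_cases hr : 0 ≤ r
        · rw [← ENNReal.ofReal_mul hr]
          congr 1
          ring
        · rw [not_le] at hr
          rw [ENNReal.ofReal_of_nonpos hr.le, zero_mul, ENNReal.ofReal_of_nonpos]
          have : 0 ≤ π * (1 - r) ^ 2 := by positivity
          nlinarith [pi_pos, sq_nonneg (1 - r)]
      · rw [indicator_of_notMem h, indicator_of_notMem h, mul_zero]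
    simp_rw [h2]
    rw [lintegral_indicator measurableSet_Iic, Measure.restrict_restrict measurableSet_Iic,
      Iic_inter_Ioi, ← ofReal_integral_eq_lintegral_ofReal]
    · rw [← intervalIntegral.integral_of_le zero_le_one, intervalIntegral.integral_const_mul,
        integral_rho_one_sub_sq, ← ENNReal.ofReal_mul (by positivity)]
      congr 1
      ring
    · exact (by fun_prop : Continuous fun ρ : ℝ => π * (ρ * (1 - ρ) ^ 2)).integrableOn_Icc.mono_set
        Ioc_subset_Icc_self
    · refine (ae_restrict_iff' measurableSet_Ioc).2 (Filter.Eventually.of_forall fun r hr => ?_)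
      have := hr.1.le
      positivity
  · exact (ENNReal.measurable_ofReal.comp (by fun_prop)).indicator measurableSet_Iic

/-- **Lovas–Andai, Table 2: `χ₁(1) = λ₄(𝔹_ℝ) = 2π²/3`** — the Lebesgue measure of the unit ball
of the operator norm on real `2 × 2` matrices. [cite: LovasAndai2017, Table 2 and §5 (χ₁(1) = 2π²/3)] -/
theorem volume_rebitOpBall : volume rebitOpBall = ENNReal.ofReal (2 * π ^ 2 / 3) := by
  rw [volume_rebitOpBall_eq_four_mul, volume_rebitConfBody,
    show (4 : ℝ≥0∞) = ENNReal.ofReal 4 by norm_num, ← ENNReal.ofReal_mul (by norm_num)]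
  congr 1
  ring

end Literature.InformationTheory.Entanglement

end
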